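import Literature.NumberTheory.EllipticCurves.SteinWuthrich2013.NonsplitUniformizationDataProofs
import Literature.NumberTheory.EllipticCurves.SteinWuthrich2013.SplitLogUniformizationProofs
import Literature.NumberTheory.LocalFields.PadicAlgebraLogSeries
import HarnessLib

/-!
# Stein–Wuthrich 2013 §4.2 at a NON-split prime: `log_E(z(P)) = u⁻¹ · log υ(P)` in `ℂ_p`
# (Silverman ATAEC §V.4; proofs only)

Topic `Literature/NumberTheory/EllipticCurves` (cluster `SteinWuthrich2013`); proof file. Cell
`bsd-eis`, seat `bsd-eis-k5-c4` g3: step N4 of the discharge of `SteinWuthrich2013.exists_isMultCanonical`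
(conjunct `hHn` of `stub_publishedFacts`, crux 4 `BSDpOnCellC`, stmt-BirchSwinnertonDyer-19034). The
`ℂ_p`-analogue of `SplitLogUniformizationProofs.padicFormalLog_param_eq_inv_u_mul_padicLog`: for an
integral `C • (W ⊗ ℂ_p) = E_q` and a `ℚ_p`-RATIONAL point `P = (x,y)` of `E₁` with one-unit Tate
parameter `υ ∈ ℂ_p` (`‖υ − 1‖ ≤ p⁻¹`), the `p`-adic formal logarithm of `W ⊗ ℚ_p` at `z(P) = −x/y`
is `u⁻¹ · L(υ)` with `L` the logarithmic series of `ℂ_p`.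

The proof avoids a `ℂ_p`-valued formal logarithm: on the subgroup `H` of one-units `v` of `ℂ_p`
whose point `ψ(φ(v)) ∈ E(ℂ_p)` is `ℚ_p`-rational, `G(v) = log_E(z(ψφ(v)))` is additive
(`TateCurve.tate_some_add_some`, `VariableChange.pointEquiv`, injectivity of `E(ℚ_p) → E(ℂ_p)`,
`padicFormalLog_formalParameter_add`) and tangent to `u⁻¹(v − 1)` to second order
(`TateCurve.norm_param_ofXY_sub_le`, `TateCurve.norm_tateParam_one_add_sub_le`,
`norm_padicFormalLog_sub_self_le_two_mul_sq`); since `υ^{pᵏ} ∈ H`,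
`G(υ) = p⁻ᵏG(υ^{pᵏ}) = u⁻¹(υ^{pᵏ} − 1)/pᵏ + O(p⁻ᵏ)`, and `(υ^{pᵏ} − 1)/pᵏ → L(υ)`
(`IwasawaLog.tendsto_pow_prime_pow_sub_one_div`).

* `padicFormalLog_param_eq_inv_u_mul_logSeries` — **`log_E(z(P)) = u⁻¹ · L(υ(P))` in `ℂ_p`**.

## Sources
* W. Stein, C. Wuthrich, Math. Comp. 82 (2013), §4.2 (`ψ^*ω_E = C du/u`). [SteinWuthrich2013]
* J. H. Silverman, *Advanced Topics in the Arithmetic of Elliptic Curves* (1994), Thm. V.3.1 (c),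
  §V.4 (PDF pp. 395–402). [SilvermanATAEC1994]
-/

noncomputable section

open scoped Classical

open Filter Topology WeierstrassCurve Literature.NumberTheory.EllipticCurves
  Literature.NumberTheory.EllipticCurves.TateCurve Literature.NumberTheory.LocalFields
  Literature.NumberTheory.Transcendental

namespace Literature.NumberTheory.EllipticCurves.SteinWuthrich2013

variable {W : WeierstrassCurve ℚ} {p : ℕ} [hp : Fact p.Prime]

/-- `‖(x : ℂ_p)‖ = ‖x‖_p`. [folklore] -/
private theorem norm_ι' (x : ℚ_[p]) : ‖algebraMap ℚ_[p] ℂ_[p] x‖ = ‖x‖ := norm_algebraMap' ℂ_[p] x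

/-- The ball `‖v − 1‖ ≤ p⁻¹` of `ℂ_p` is closed under products. [folklore] -/
private theorem norm_mul_sub_one_le' {v w : ℂ_[p]} (hv : ‖v - 1‖ ≤ (p : ℝ)⁻¹)
    (hw : ‖w - 1‖ ≤ (p : ℝ)⁻¹) : ‖v * w - 1‖ ≤ (p : ℝ)⁻¹ := by
  have hpinv1 : (p : ℝ)⁻¹ < 1 := inv_lt_one_of_one_lt₀ (by exact_mod_cast hp.out.one_lt)
  have e : v * w - 1 = (v - 1) * w + (w - 1) := by ring
  rw [e]
  refine (IsUltrametricDist.norm_add_le_max _ _).trans (max_le ?_ hw)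
  rw [norm_mul, norm_eq_one_of_norm_sub_one_lt (hw.trans_lt hpinv1), mul_one]
  exact hv

/-- **Stein–Wuthrich's `ψ^*(ω_E) = C du/u` at a non-split prime, integrated in `ℂ_p`:
`log_E(z(P)) = u⁻¹ · L(υ(P))`.** Let `W/ℚ` be `ℤ`-integral elliptic, `p` prime, `0 < ‖q‖_p < 1`,
`C = (u,r,s,t)` integral over `ℂ_p` (`‖u‖ = 1`, `‖r‖,‖s‖,‖t‖ ≤ 1`) with `C • (W ⊗ ℂ_p) = E_q`. If
`P = (x,y) ∈ E(ℚ)` and `υ ∈ ℂ_p`, `‖υ − 1‖ ≤ p⁻¹`, `υ ≠ 1`, has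
`(X(υ), Y(υ)) = (u⁻²(x−r), u⁻³(y − s(x−r) − t))`, then
`log_{W ⊗ ℚ_p}(−x/y) = u⁻¹ · Σₙ −(1−υ)^{n+1}/(n+1)` in `ℂ_p`. [Stein–Wuthrich 2013, §4.2 (p. 15);
Silverman ATAEC V.3.1 (c), §V.4] [cite: SteinWuthrich2013, §4.2 (p. 15)]
[cite: SilvermanATAEC1994, Thm. V.3.1 (c) and §V.4 (PDF pp. 395–402)] -/
theorem padicFormalLog_param_eq_inv_u_mul_logSeries (W : WeierstrassCurve ℚ) [W.IsElliptic]
    [W.IsIntegral ℤ] {q : ℚ_[p]} (hq0 : q ≠ 0) (hq : ‖q‖ < 1) {C : VariableChange ℂ_[p]}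
    (hC : C • (W.baseChange ℚ_[p]).map (algebraMap ℚ_[p] ℂ_[p]) = tateCurve (algebraMap ℚ_[p] ℂ_[p] q))
    (hu : ‖(C.u : ℂ_[p])‖ = 1) (hr : ‖C.r‖ ≤ 1) (hs : ‖C.s‖ ≤ 1) (ht : ‖C.t‖ ≤ 1) {x y : ℚ}
    (hxy : W.toAffine.Nonsingular x y) {υ : ℂ_[p]} (hυ1 : ‖υ - 1‖ ≤ (p : ℝ)⁻¹) (hυne : υ ≠ 1)
    (hX : tateX (algebraMap ℚ_[p] ℂ_[p] q) υ = C.toX (algebraMap ℚ_[p] ℂ_[p] (x : ℚ_[p])))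
    (hY : tateY (algebraMap ℚ_[p] ℂ_[p] q) υ =
      C.toY (algebraMap ℚ_[p] ℂ_[p] (x : ℚ_[p])) (algebraMap ℚ_[p] ℂ_[p] (y : ℚ_[p]))) :
    algebraMap ℚ_[p] ℂ_[p] ((W.baseChange ℚ_[p]).padicFormalLog (-(x : ℚ_[p]) / y)) =
      (C.u : ℂ_[p])⁻¹ * ∑' n : ℕ, -((1 - υ) ^ (n + 1)) / (n + 1 : ℂ_[p]) := by
  set ι := algebraMap ℚ_[p] ℂ_[p] with hι
  set qc := ι q with hqc
  set E₀ : WeierstrassCurve ℚ_[p] := W.baseChange ℚ_[p] with hE₀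
  haveI : E₀.IsIntegral ℤ_[p] := by rw [hE₀]; infer_instance
  set E : WeierstrassCurve ℂ_[p] := E₀.map ι with hE
  set T : WeierstrassCurve ℂ_[p] := C • E with hT
  set toC : E₀.toAffine.Point →+ E.toAffine.Point :=
    Affine.Point.map (W' := E₀.toAffine) (S := ℚ_[p]) (Algebra.ofId ℚ_[p] ℂ_[p]) with htoC
  have htoC_inj : Function.Injective toC := Affine.Point.map_injective (W' := E₀.toAffine) _
  have htoC_some : ∀ {a b : ℚ_[p]} (h : E₀.toAffine.Nonsingular a b),
      toC (.some a b h) = .some (ι a) (ι b) (nonsingular_algebraMap_padicComplex h) :=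
    fun h => toComplexPoint_some E₀ h
  have hp0 : (0 : ℝ) < p := by exact_mod_cast hp.out.pos
  have hpinv1 : (p : ℝ)⁻¹ < 1 := inv_lt_one_of_one_lt₀ (by exact_mod_cast hp.out.one_lt)
  have hq' : ‖qc‖ < 1 := by rw [hqc, norm_ι']; exact hq
  have hq0' : qc ≠ 0 := (map_ne_zero _).mpr hq0
  have hu0 : (C.u : ℂ_[p]) ≠ 0 := C.u.ne_zero
  have hui : ‖(C.u : ℂ_[p])⁻¹‖ = 1 := by rw [norm_inv, hu, inv_one]
  -- one-units `v ≠ 1` are off `q^ℤ` and give points of `T = E_q`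
  have hvq : ∀ {v : ℂ_[p]}, ‖v - 1‖ < 1 → v ≠ 1 → ∀ n : ℤ, v ≠ qc ^ n := fun hv hne =>
    ne_zpow_of_norm_eq_one hq' (norm_eq_one_of_norm_sub_one_lt hv) hne
  have hv0 : ∀ {v : ℂ_[p]}, ‖v - 1‖ < 1 → v ≠ 0 := fun hv h0 => by
    have := norm_eq_one_of_norm_sub_one_lt hv; rw [h0, norm_zero] at this; exact zero_ne_one this
  have nonsT : ∀ {v : ℂ_[p]} (hv : ‖v - 1‖ < 1 ∧ v ≠ 1),
      T.toAffine.Nonsingular (tateX qc v) (tateY qc v) := by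
    intro v hv
    have hns := tatePoint_nonsingular hq0' hq' (Units.mk0 v (hv0 hv.1)) (hvq hv.1 hv.2)
    rw [← hC] at hns
    exact hns
  -- the points `Pt v` of `T`
  let Pt : ℂ_[p] → T.toAffine.Point := fun v =>
    if hv : ‖v - 1‖ < 1 ∧ v ≠ 1 then .some _ _ (nonsT hv) else 0
  have Pt_pos : ∀ {v : ℂ_[p]} (hv : ‖v - 1‖ < 1 ∧ v ≠ 1), Pt v = .some _ _ (nonsT hv) :=
    fun hv => dif_pos hv
  have Pt_one : Pt 1 = 0 := dif_neg (by simp)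
  -- (A) additivity of `Pt`
  have Pt_mul : ∀ {v w : ℂ_[p]}, ‖v - 1‖ < 1 → ‖w - 1‖ < 1 → Pt (v * w) = Pt v + Pt w := by
    intro v w hv hw
    by_cases hv1 : v = 1
    · rw [hv1, one_mul, Pt_one, zero_add]
    by_cases hw1 : w = 1
    · rw [hw1, mul_one, Pt_one, add_zero]
    rw [Pt_pos ⟨hv, hv1⟩, Pt_pos ⟨hw, hw1⟩]
    by_cases hvw : v * w = 1
    · rw [hvw, Pt_one]
      exact (TateCurve.tate_some_add_some_eq_zero hq0' hq' T (hT.trans hC) (u := Units.mk0 v (hv0 hv))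
        (v := Units.mk0 w (hv0 hw)) (hvq hv hv1) (hvq hw hw1) (n := 0)
        (by rw [zpow_zero]; exact hvw) _ _).symm
    · have hvw' : ‖v * w - 1‖ < 1 ∧ v * w ≠ 1 := ⟨norm_mul_sub_one_lt' hv hw, hvw⟩
      rw [Pt_pos hvw']
      exact (TateCurve.tate_some_add_some hq0' hq' T (hT.trans hC) (u := Units.mk0 v (hv0 hv))
        (v := Units.mk0 w (hv0 hw)) (hvq hv hv1) (hvq hw hw1) (hvq hvw'.1 hvw'.2) _ _
        (nonsT hvw')).symm
  -- the subgroup `H` of one-units whose point is `ℚ_p`-rational, and the rational point `Rf v`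
  set ψ := (VariableChange.pointEquiv E C).symm with hψ
  have hex : ∀ v : ℂ_[p], ∃ R : E₀.toAffine.Point,
      ((∃ R' : E₀.toAffine.Point, toC R' = ψ (Pt v)) → toC R = ψ (Pt v)) := by
    intro v
    by_cases h : ∃ R' : E₀.toAffine.Point, toC R' = ψ (Pt v)
    · obtain ⟨R', hR'⟩ := h; exact ⟨R', fun _ => hR'⟩
    · exact ⟨0, fun h' => absurd h' h⟩
  choose Rf hRf using hex
  -- `H`-membership is multiplicative, and `Rf` is additive on `H`
  have H_mul : ∀ {v w : ℂ_[p]}, ‖v - 1‖ < 1 → ‖w - 1‖ < 1 →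
      (∃ R', toC R' = ψ (Pt v)) → (∃ R', toC R' = ψ (Pt w)) →
      (∃ R', toC R' = ψ (Pt (v * w))) ∧ Rf (v * w) = Rf v + Rf w := by
    intro v w hv hw hHv hHw
    have h1 : toC (Rf v + Rf w) = ψ (Pt (v * w)) := by
      rw [map_add, hRf v hHv, hRf w hHw, Pt_mul hv hw, map_add]
    refine ⟨⟨_, h1⟩, htoC_inj ?_⟩
    rw [hRf (v * w) ⟨_, h1⟩, h1]
  -- `Rf v ∈ E₁(ℚ_p)` for `v ∈ H`
  have mem : ∀ {v : ℂ_[p]}, ‖v - 1‖ < 1 → (∃ R', toC R' = ψ (Pt v)) →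
      E₀.IsInReductionKernel (Rf v) := by
    intro v hv hHv
    have hR := hRf v hHv
    by_cases hv1 : v = 1
    · subst hv1
      rw [Pt_one, map_zero] at hR
      rw [htoC_inj (hR.trans (map_zero toC).symm)]
      exact E₀.isInReductionKernel_zero
    rw [Pt_pos ⟨hv, hv1⟩, hψ, VariableChange.pointEquiv_symm_apply, VariableChange.pointInv_some] at hR
    have hXv : 1 < ‖tateX qc v‖ := by
      have := TateCurve.one_lt_norm_tateX_one_add hq' hv (sub_ne_zero.mpr hv1) (t := v - 1)
      rwa [add_sub_cancel] at this
    have h1 := (TateCurve.norm_param_ofXY_sub_le hq' hC hu hr hs ht (nonsT ⟨hv, hv1⟩) hXv).1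
    -- `Rf v` is an affine point with `ι x = C.ofX (X v)`
    rcases hRv : Rf v with _ | ⟨xR, yR, hRns⟩
    · exact E₀.isInReductionKernel_zero
    · rw [hRv, htoC_some] at hR
      simp only [WeierstrassCurve.Affine.Point.some.injEq] at hR
      show 1 < ‖xR‖
      rw [← norm_ι', hR.1]
      exact h1
  -- the function `G` and its additivity on `H`
  let G : ℂ_[p] → ℚ_[p] := fun v => E₀.padicFormalLog (E₀.formalParameter (Rf v))
  have G_mul : ∀ {v w : ℂ_[p]}, ‖v - 1‖ < 1 → ‖w - 1‖ < 1 →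
      (∃ R', toC R' = ψ (Pt v)) → (∃ R', toC R' = ψ (Pt w)) → G (v * w) = G v + G w := by
    intro v w hv hw hHv hHw
    show E₀.padicFormalLog (E₀.formalParameter (Rf (v * w))) =
      E₀.padicFormalLog (E₀.formalParameter (Rf v)) + E₀.padicFormalLog (E₀.formalParameter (Rf w))
    rw [(H_mul hv hw hHv hHw).2]
    exact padicFormalLog_formalParameter_add E₀ (mem hv hHv) (mem hw hHw)
  -- (D) tangency on `H`: `‖ι(G v) − u⁻¹(v − 1)‖ ≤ 2‖v − 1‖²`
  have G_tan : ∀ {v : ℂ_[p]}, ‖v - 1‖ ≤ (p : ℝ)⁻¹ → v ≠ 1 → (∃ R', toC R' = ψ (Pt v)) →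
      ‖ι (G v) - (C.u : ℂ_[p])⁻¹ * (v - 1)‖ ≤ 2 * ‖v - 1‖ ^ 2 := by
    intro v hv hv1 hHv
    have hv' : ‖v - 1‖ < 1 := hv.trans_lt hpinv1
    set t := v - 1 with htdef
    have ht0 : t ≠ 0 := sub_ne_zero.mpr hv1
    have htv : v = 1 + t := by rw [htdef]; ring
    have hvv : ‖v - 1‖ < 1 ∧ v ≠ 1 := ⟨hv', hv1⟩
    -- the rational point `Rf v = (xR, yR)` with `ι xR = C.ofX (X v)`, `ι yR = C.ofY (X v) (Y v)`
    have hR := hRf v hHv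
    rw [Pt_pos hvv, hψ, VariableChange.pointEquiv_symm_apply, VariableChange.pointInv_some] at hR
    have hXv : 1 < ‖tateX qc v‖ := by
      have := TateCurve.one_lt_norm_tateX_one_add hq' hv' ht0; rwa [← htv] at this
    obtain ⟨-, hofY0, hzz'⟩ := TateCurve.norm_param_ofXY_sub_le hq' hC hu hr hs ht (nonsT hvv) hXv
    obtain ⟨hz't, hz'n⟩ := TateCurve.norm_tateParam_one_add_sub_le hq' hv' ht0 (q := qc)
    rw [← htv] at hz't hz'n
    rcases hRv : Rf v with _ | ⟨xR, yR, hRns⟩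
    · rw [hRv] at hR
      change toC 0 = _ at hR
      rw [map_zero] at hR
      exact absurd hR.symm (WeierstrassCurve.Affine.Point.some_ne_zero _)
    rw [hRv, htoC_some] at hR
    simp only [WeierstrassCurve.Affine.Point.some.injEq] at hR
    obtain ⟨hxR, hyR⟩ := hR
    have hGv : G v = E₀.padicFormalLog (-xR / yR) := by
      show E₀.padicFormalLog (E₀.formalParameter (Rf v)) = _
      rw [hRv, E₀.formalParameter_some]
    set z' := -tateX qc v / tateY qc v with hz'def
    set zc := -C.ofX (tateX qc v) / C.ofY (tateX qc v) (tateY qc v) with hzcdef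
    have hιz : ι (-xR / yR) = zc := by rw [map_div₀, map_neg, hxR, hyR]
    -- norms
    have hzz'' : ‖zc - (C.u : ℂ_[p])⁻¹ * z'‖ ≤ ‖t‖ ^ 2 := by rw [← hz'n]; exact hzz'
    have huz' : ‖(C.u : ℂ_[p])⁻¹ * z'‖ = ‖t‖ := by rw [norm_mul, hui, one_mul, hz'n]
    have htpos : 0 < ‖t‖ := norm_pos_iff.mpr ht0
    have hzn : ‖zc‖ = ‖t‖ := by
      have hlt : ‖zc - (C.u : ℂ_[p])⁻¹ * z'‖ < ‖(C.u : ℂ_[p])⁻¹ * z'‖ := by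
        rw [huz']
        refine hzz''.trans_lt ?_
        calc ‖t‖ ^ 2 = ‖t‖ * ‖t‖ := sq _
          _ < ‖t‖ * 1 := mul_lt_mul_of_pos_left hv' htpos
          _ = ‖t‖ := mul_one _
      have := IsUltrametricDist.norm_add_eq_max_of_norm_ne_norm hlt.ne
      rw [sub_add_cancel, max_eq_right hlt.le, huz'] at this
      exact this
    have hzRn : ‖-xR / yR‖ = ‖t‖ := by rw [← norm_ι', hιz, hzn]
    have hlog : ‖ι (E₀.padicFormalLog (-xR / yR)) - zc‖ ≤ 2 * ‖t‖ ^ 2 := by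
      rw [← hιz, ← map_sub, norm_ι', ← hzRn]
      exact norm_padicFormalLog_sub_self_le_two_mul_sq E₀ (by rw [hzRn]; exact hv)
    -- combine
    have e : ι (G v) - (C.u : ℂ_[p])⁻¹ * t =
        (ι (E₀.padicFormalLog (-xR / yR)) - zc) + (zc - (C.u : ℂ_[p])⁻¹ * z') +
          (C.u : ℂ_[p])⁻¹ * (z' - t) := by rw [hGv]; ring
    rw [e]
    have ht2 : ‖t‖ ^ 2 ≤ 2 * ‖t‖ ^ 2 := by nlinarith [sq_nonneg ‖t‖]
    refine (IsUltrametricDist.norm_add_le_max _ _).trans (max_le ?_ ?_)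
    · exact (IsUltrametricDist.norm_add_le_max _ _).trans (max_le hlog (hzz''.trans ht2))
    · rw [norm_mul, hui, one_mul]; exact hz't.trans ht2
  -- (E) `υ ∈ H`, with `Rf υ = P`
  have hυ' : ‖υ - 1‖ < 1 := hυ1.trans_lt hpinv1
  have hP₀ : E₀.toAffine.Nonsingular (x : ℚ_[p]) (y : ℚ_[p]) := nonsingular_ratCast hxy
  have hψυ : ψ (Pt υ) = .some (ι (x : ℚ_[p])) (ι (y : ℚ_[p])) (nonsingular_algebraMap_padicComplex hP₀) := by
    rw [Pt_pos ⟨hυ', hυne⟩, hψ, VariableChange.pointEquiv_symm_apply, VariableChange.pointInv_some]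
    have hcx : C.ofX (tateX qc υ) = ι (x : ℚ_[p]) := by rw [hX, VariableChange.ofX_toX]
    have hcy : C.ofY (tateX qc υ) (tateY qc υ) = ι (y : ℚ_[p]) := by
      rw [hX, hY, VariableChange.ofY_toY]
    simp only [hcx, hcy]
  have hHυ : ∃ R', toC R' = ψ (Pt υ) := ⟨.some _ _ hP₀, (htoC_some hP₀).trans hψυ.symm⟩
  have hGυ : G υ = E₀.padicFormalLog (-(x : ℚ_[p]) / y) := by
    have hR := hRf υ hHυ
    have hRυ : Rf υ = .some _ _ hP₀ := htoC_inj (hR.trans (hψυ.trans (htoC_some hP₀).symm))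
    show E₀.padicFormalLog (E₀.formalParameter (Rf υ)) = _
    rw [hRυ, E₀.formalParameter_some]
  -- powers of `υ` stay in `H`, and `G(υ^{n}) = n G(υ)`
  have hpow : ∀ n : ℕ, (∃ R', toC R' = ψ (Pt (υ ^ (n + 1)))) ∧ ‖υ ^ (n + 1) - 1‖ ≤ (p : ℝ)⁻¹ ∧
      G (υ ^ (n + 1)) = (n + 1 : ℕ) * G υ := by
    intro n
    induction n with
    | zero => simp only [zero_add, pow_one, Nat.cast_one, one_mul]; exact ⟨hHυ, hυ1, trivial⟩
    | succ n ih =>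
      obtain ⟨hH, hn, hG⟩ := ih
      have hn' : ‖υ ^ (n + 1) - 1‖ < 1 := hn.trans_lt hpinv1
      refine ⟨?_, ?_, ?_⟩
      · rw [pow_succ]; exact (H_mul hn' hυ' hH hHυ).1
      · rw [pow_succ]; exact norm_mul_sub_one_le' hn hυ1
      · rw [pow_succ, G_mul hn' hυ' hH hHυ, hG]; push_cast; ring
  -- (F) the limit: `ι(G υ) = u⁻¹ (υ^{pᵏ} − 1)/pᵏ + O(p⁻ᵏ)`
  have hpk : ∀ k : ℕ, p ^ k = (p ^ k - 1) + 1 := fun k => (Nat.sub_add_cancel (Nat.one_le_pow k p hp.out.pos)).symm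
  have hest : ∀ k : ℕ, ‖ι (G υ) - (C.u : ℂ_[p])⁻¹ * ((υ ^ p ^ k - 1) / (p : ℂ_[p]) ^ k)‖ ≤
      2 * ((p : ℝ)⁻¹) ^ k * ‖υ - 1‖ ^ 2 := by
    intro k
    obtain ⟨hH, hn, hG⟩ := hpow (p ^ k - 1)
    rw [← hpk] at hH hn hG
    have hne1 : υ ^ p ^ k ≠ 1 ∨ υ ^ p ^ k = 1 := (em _).symm
    have hpk0 : ((p : ℂ_[p]) ^ k) ≠ 0 := pow_ne_zero _ (by
      have h := PadicAlgebra.norm_prime_eq (p := p) (F := ℂ_[p])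
      intro h0; rw [h0, norm_zero] at h; exact (inv_pos.mpr hp0).ne h)
    have hnpk : ‖((p : ℂ_[p]) ^ k)‖ = ((p : ℝ)⁻¹) ^ k := by
      rw [norm_pow, PadicAlgebra.norm_prime_eq (p := p) (F := ℂ_[p])]
    -- `ι(G υ) = ι(G(υ^{p^k}))/p^k`
    have hGk : ι (G υ) = ι (G (υ ^ p ^ k)) / (p : ℂ_[p]) ^ k := by
      rw [hG, map_mul, map_natCast]
      have : (((p ^ k : ℕ)) : ℂ_[p]) = (p : ℂ_[p]) ^ k := by push_cast; ring
      rw [this]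
      field_simp
    have hbound : ‖υ ^ p ^ k - 1‖ ≤ ((p : ℝ)⁻¹) ^ k * ‖υ - 1‖ := by
      have h := PadicAlgebra.norm_one_add_pow_prime_pow_sub_one_le (p := p) (F := ℂ_[p])
        (t := υ - 1) hυ1 k
      rwa [add_sub_cancel] at h
    rcases hne1 with hne | heq
    · have htan := G_tan hn hne hH
      have e : ι (G υ) - (C.u : ℂ_[p])⁻¹ * ((υ ^ p ^ k - 1) / (p : ℂ_[p]) ^ k) =
          (ι (G (υ ^ p ^ k)) - (C.u : ℂ_[p])⁻¹ * (υ ^ p ^ k - 1)) / (p : ℂ_[p]) ^ k := by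
        rw [hGk]; field_simp
      rw [e, norm_div, hnpk, div_le_iff₀ (pow_pos (inv_pos.mpr hp0) k)]
      refine htan.trans ?_
      calc 2 * ‖υ ^ p ^ k - 1‖ ^ 2 ≤ 2 * (((p : ℝ)⁻¹) ^ k * ‖υ - 1‖) ^ 2 := by gcongr
        _ = 2 * ((p : ℝ)⁻¹) ^ k * ‖υ - 1‖ ^ 2 * ((p : ℝ)⁻¹) ^ k := by ring
    · -- degenerate case `υ^{p^k} = 1`: then `G(υ^{p^k}) = 0`
      have hG0 : G (υ ^ p ^ k) = 0 := by
        have hR := hRf _ hH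
        show E₀.padicFormalLog (E₀.formalParameter (Rf (υ ^ p ^ k))) = 0
        rw [heq] at hR ⊢
        rw [Pt_one, map_zero] at hR
        rw [htoC_inj (hR.trans (map_zero toC).symm), E₀.formalParameter_zero, E₀.padicFormalLog_zero]
      rw [hGk, hG0, map_zero, zero_div, heq, sub_self, zero_div, mul_zero, sub_zero, norm_zero]
      positivity
  have hlimL : Tendsto (fun k : ℕ => (C.u : ℂ_[p])⁻¹ * ((υ ^ p ^ k - 1) / (p : ℂ_[p]) ^ k)) atTop
      (𝓝 ((C.u : ℂ_[p])⁻¹ * ∑' n : ℕ, -((1 - υ) ^ (n + 1)) / (n + 1 : ℂ_[p]))) :=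
    (IwasawaLog.tendsto_pow_prime_pow_sub_one_div (p := p) υ
      (by rw [norm_sub_rev]; exact hυ')).const_mul _
  have hlim0 : Tendsto (fun k : ℕ => 2 * ((p : ℝ)⁻¹) ^ k * ‖υ - 1‖ ^ 2) atTop (𝓝 0) := by
    have := (tendsto_pow_atTop_nhds_zero_of_lt_one (inv_nonneg.mpr hp0.le) hpinv1).const_mul 2
      |>.mul_const (‖υ - 1‖ ^ 2)
    simpa using this
  have hconst : Tendsto (fun k : ℕ => (C.u : ℂ_[p])⁻¹ * ((υ ^ p ^ k - 1) / (p : ℂ_[p]) ^ k)) atTop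
      (𝓝 (ι (G υ))) := by
    rw [tendsto_iff_norm_sub_tendsto_zero]
    refine squeeze_zero (fun k => norm_nonneg _) (fun k => ?_) hlim0
    rw [norm_sub_rev]; exact hest k
  rw [← hGυ]
  exact tendsto_nhds_unique hconst hlimL

end Literature.NumberTheory.EllipticCurves.SteinWuthrich2013

end
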